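import Summits.ResolutionOfSingularities.ResolutionOfSingularities.Theorems.EquisingularLiftEquisingularLiftNatDirectionCentreChartRing
import Summits.ResolutionOfSingularities.ResolutionOfSingularities.Theorems.EquisingularLiftEquisingularLiftNatBlowupChartPointOfPrime
import Summits.ResolutionOfSingularities.ResolutionOfSingularities.Theorems.EquisingularLiftEquisingularLiftNatCarrierDeltaStalks
import Literature.AlgebraicGeometry.Resolution.AlterationsSectionDivisor
import Literature.AlgebraicGeometry.Resolution.MarkedIdealsLemmas
import Literature.AlgebraicGeometry.Resolution.BlowupsProperProofs
import Mathlib.AlgebraicGeometry.Morphisms.IsIso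
import Mathlib.AlgebraicGeometry.Morphisms.UniversallyClosed
import HarnessLib

/-!
# [OURS · L1 W4.5(b) · EL♮(3)] T-DIRLIFT part D3 — THE DIRECTION CENTRE IS A SECTION: `V(Γ̃) ≅ C` OVER `X`

Crux chain w45b (cell `res-hironaka`, slot W4.5(b)), working crux **EL♮** = stmt-ResolutionOfSingularities-20038, child **EL♮(3)** =
stmt-ResolutionOfSingularities-20148, route EquisingularLift, line `sections`; supplier object **T-DIRLIFT** (plan-1 CHAIN v7.24 O2;
res-type-027 credited), part D3 (consumer: res-D-pv-029 g8's `towerRoundCech_brick`; also DIR₀ `stub_elnat_dirZeroPointResolution`).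
HONEST FRAMING: OURS; NOT a statement of any manuscript; AI-written, weaker than expert review. No `sorry`; standard axioms. DEF-FREE.
`--supports stmt-ResolutionOfSingularities-20148 --as helper`.

SETTING. `τ : X₁ → X` a blowing up along the ideal `I` of the in-carrier curve `C = V(I)` (`IsBlowup`, universal property), `𝒟` a
DIRECTION along `C`: `I·I ≤ 𝒟` and at every `x ∈ C` a quasi-regular frame `I_x = (c 0, c 1) = (ℓ, m)` with `𝒟_x = (ℓ) + (m²)`; the
DIRECTION CENTRE is `Γ̃ := controlledTransform τ I 𝒟 1 = (τ^*𝒟 : E_C)` (…NatDirectionCentre p547943: `Γ̃ = (m, ℓ/m)` on the chart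
`m`, `= ⊤` on the chart `ℓ`).

WHAT.
* `stalkIdeal_directionCentre_eq_map` — `Γ̃_y = 𝔞·𝒪_{X₁,y}` for the chart ideal `𝔞 = (m, ℓ/m)` and a chart-`m` presentation.
* `exists_chartOnePresentation_of_mem_support` — a point of `V(Γ̃)` over `x` is presented on the chart `m`, at a prime `𝔔 ⊇ 𝔞`.
* `eq_of_mem_support_directionCentre` / `exists_mem_support_directionCentre` — over every `x ∈ C` there is EXACTLY ONE point of `V(Γ̃)`.
* `surjective_mk_comp_of_mem_support_directionCentre` / `comap_stalkIdeal_directionCentre` — at that point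
  `𝒪_{X,x} → 𝒪_{X₁,y} ⧸ Γ̃_y` is surjective with kernel `I_x` (the stalk of `V(Γ̃)` is the stalk of `C`).
* **`exists_subschemeIso_directionCentre`** — for `τ` universally closed: **`V(Γ̃) ≅ V(I) = C` over `X`**, i.e. an isomorphism
  `e : Γ̃.subscheme ≅ I.subscheme` with `e.hom ≫ ι_C = ι_{Γ̃} ≫ τ` (`V(Γ̃)` is a section of `E_C → C`). Consequences for the consumer (one-liners
  along `e`): `V(Γ̃)` is regular / integral / `O`-flat / a rational carrier whenever `C` is;
  `exists_subschemeIso_directionCentre_of_isLocallyNoetherian` — the same over a locally Noetherian `X` (`τ` is then proper).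

PROOF. `φ : V(Γ̃) → C` is Mathlib's `subschemeMap` (`I ≤ τ_* Γ̃` from `I·I ≤ 𝒟`); it is bijective (chart primes `⊇ 𝔞` are
determined by their trace, …NatDirectionCentreChartRing) and closed (`τ` universally closed), so a homeomorphism; its stalk maps are
bijective by the ring computation `A ↠ B_𝔔 ⧸ 𝔞 B_𝔔` with kernel `I`; Mathlib's `isomorphisms_eq_stalkwise` concludes.

References: The Stacks Project, Tags 0804, 052P, 01J5 — through the tree (…NatDirectionCentre / …Regular / …ChartRing; T-PTPRIME
dictionary p526020 `exists_point_presentation_of_blowupAlgebra_prime`, p540294 `exists_chartPresentation_of_eq` /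
`eq_of_chartPresentation_of_prime_eq` / `mem_chartPrime_iff_apply_mem_maximalIdeal`; `isLocalization_stalk_of_ringEquiv`;
Literature `stalkIdeal_ker_eq_ker_stalkMap`, `comap_mul`, `le_colon_iff`; Mathlib `subschemeMap`, `isomorphisms_eq_stalkwise`,
`TopCat.isIso_of_bijective_of_isClosedMap`).
-/

set_option linter.dupNamespace false -- mandated namespace `Summit.<Summit>.<Problem>` of this single-conjunct summit

noncomputable section

open CategoryTheory CategoryTheory.Limits AlgebraicGeometry TopologicalSpace IsLocalRing
open Literature.AlgebraicGeometry.Resolution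
open AlgebraicGeometry.Scheme.IdealSheafData

namespace Summit.ResolutionOfSingularities.ResolutionOfSingularities.Cruxes.EquisingularLiftNat.Sections

universe u

variable {X₁ X : Scheme.{u}} {τ : X₁ ⟶ X} {I : X.IdealSheafData}

/-! ## 1. Currency bridge and the stalk of `Γ̃` on the chart `m` -/

/-- The two spellings of `τ♯ : 𝒪_{X,x} → 𝒪_{X₁,y}` for `τ y = x` agree (both are `stalkSpecializes` then `τ.stalkMap y`); explicit-argument
twin of `stalkCongr_inv_comp_apply_eq` (…NatClusterPointChartChange, not imported here to keep the import cone small). [folklore] -/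
theorem stalkCongr_inv_comp_stalkMap_hom_apply (τ : X₁ ⟶ X) (y : X₁) {x : X} (hy : τ y = x) (a : X.presheaf.stalk x) :
    ((X.presheaf.stalkCongr (.of_eq hy)).inv ≫ τ.stalkMap y).hom a =
      (τ.stalkMap y).hom ((X.presheaf.stalkCongr (.of_eq hy.symm)).hom a) := by
  subst hy
  rfl

/-- **`Γ̃_y = 𝔞·𝒪_{X₁,y}`** on the chart `m = c 1`, `𝔞 = (m/1) + (c_j/m : j ≠ 1) = (m, ℓ/m)` (…NatDirectionCentre D1, re-spelled with
the chart ideal of …NatDirectionCentreChartRing). [cite: StacksProject, Tag 0804] -/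
theorem stalkIdeal_directionCentre_eq_map (hτ : IsBlowup τ I) (𝒟 : X.IdealSheafData) (y : X₁) {x : X} (hy : τ y = x)
    (c : Fin 2 → X.presheaf.stalk x) (hc : Ideal.span (Set.range c) = stalkIdeal I x)
    (h𝒟 : stalkIdeal 𝒟 x = Ideal.span {c 0} ⊔ Ideal.span {c 1 * c 1})
    (χ : blowupAlgebra (Ideal.span (Set.range c)) (c 1) →+* X₁.presheaf.stalk y)
    (hχ : ∀ a, χ (algebraMap _ _ a) = ((X.presheaf.stalkCongr (.of_eq hy)).inv ≫ τ.stalkMap y).hom a) :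
    stalkIdeal (controlledTransform τ I 𝒟 1) y =
      (Ideal.span {algebraMap _ (blowupAlgebra (Ideal.span (Set.range c)) (c 1)) (c 1)} ⊔
        Ideal.span (Set.range fun j : {j : Fin 2 // j ≠ 1} => blowupAlgebra.frac c 1 j.1)).map χ := by
  have hfr : (Set.range fun j : {j : Fin 2 // j ≠ 1} => blowupAlgebra.frac c 1 j.1) = {blowupAlgebra.frac c 1 0} := by
    ext b
    simp only [Set.mem_range, Set.mem_singleton_iff]
    constructor
    · rintro ⟨⟨j, hj⟩, rfl⟩
      have : j = 0 := by omega
      subst this; rfl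
    · rintro rfl; exact ⟨⟨0, by omega⟩, rfl⟩
  obtain ⟨-, hΓ⟩ := stalkIdeal_directionCentre_of_chart_one hτ 𝒟 y hy c hc h𝒟 χ hχ
  rw [hΓ, hfr, Ideal.map_sup, Ideal.map_span, Ideal.map_span, Set.image_singleton, Set.image_singleton, ← hχ]

/-! ## 2. Points of `V(Γ̃)`: chart-`m` presentation, uniqueness and existence over each `x ∈ C` -/

/-- **A point of `V(Γ̃)` over `x` is presented on the chart `m`, at a prime containing `𝔞`** (on the chart `ℓ` the stalk of `Γ̃` is the
unit ideal). [cite: StacksProject, Tag 0804] -/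
theorem exists_chartOnePresentation_of_mem_support (hτ : IsBlowup τ I) (𝒟 : X.IdealSheafData) (y : X₁) {x : X} (hy : τ y = x)
    (c : Fin 2 → X.presheaf.stalk x) (hc : Ideal.span (Set.range c) = stalkIdeal I x)
    (h𝒟 : stalkIdeal 𝒟 x = Ideal.span {c 0} ⊔ Ideal.span {c 1 * c 1})
    (hyΓ : y ∈ (controlledTransform τ I 𝒟 1).support) :
    ∃ (𝔔 : PrimeSpectrum (blowupAlgebra (Ideal.span (Set.range c)) (c 1)))
      (χ : blowupAlgebra (Ideal.span (Set.range c)) (c 1) →+* X₁.presheaf.stalk y),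
      (∀ a, χ (algebraMap _ _ a) = ((X.presheaf.stalkCongr (.of_eq hy)).inv ≫ τ.stalkMap y).hom a) ∧
      @IsLocalization.AtPrime _ _ (X₁.presheaf.stalk y) _ χ.toAlgebra 𝔔.asIdeal _ ∧
      𝔔.asIdeal.comap (algebraMap _ (blowupAlgebra (Ideal.span (Set.range c)) (c 1))) = maximalIdeal (X.presheaf.stalk x) ∧
      Ideal.span {algebraMap _ (blowupAlgebra (Ideal.span (Set.range c)) (c 1)) (c 1)} ⊔
          Ideal.span (Set.range fun j : {j : Fin 2 // j ≠ 1} => blowupAlgebra.frac c 1 j.1) ≤ 𝔔.asIdeal := by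
  have h := exists_chartPresentation_of_eq hτ y hy c hc
  have hΓle : stalkIdeal (controlledTransform τ I 𝒟 1) y ≤ maximalIdeal _ := (mem_support_iff_stalkIdeal_le _ _).mp hyΓ
  rcases Fin.exists_fin_two.mp h with ⟨𝔔, χ, hχ, -, -⟩ | ⟨𝔔, χ, hχ, hloc, h𝔔⟩
  · exfalso
    have htop := stalkIdeal_directionCentre_of_chart_zero hτ 𝒟 y hy c hc h𝒟 χ hχ
    rw [htop, top_le_iff] at hΓle
    exact (maximalIdeal.isMaximal _).ne_top hΓle
  · refine ⟨𝔔, χ, hχ, hloc, h𝔔, fun b hb => ?_⟩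
    rw [mem_chartPrime_iff_apply_mem_maximalIdeal 𝔔 χ hloc]
    apply hΓle
    rw [stalkIdeal_directionCentre_eq_map hτ 𝒟 y hy c hc h𝒟 χ hχ]
    exact Ideal.mem_map_of_mem _ hb

/-- **Uniqueness: over each `x ∈ C` there is at most one point of `V(Γ̃)`** (two chart-`m` primes containing `𝔞` and lying over `𝔪_x`
coincide, and a point of a blow-up is determined by its chart prime). [cite: StacksProject, Tag 0804] -/
theorem eq_of_mem_support_directionCentre (hτ : IsBlowup τ I) (𝒟 : X.IdealSheafData) {x : X}
    (c : Fin 2 → X.presheaf.stalk x) (hc : Ideal.span (Set.range c) = stalkIdeal I x)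
    (h𝒟 : stalkIdeal 𝒟 x = Ideal.span {c 0} ⊔ Ideal.span {c 1 * c 1})
    {y₁ y₂ : X₁} (h₁ : τ y₁ = x) (h₂ : τ y₂ = x)
    (hy₁ : y₁ ∈ (controlledTransform τ I 𝒟 1).support) (hy₂ : y₂ ∈ (controlledTransform τ I 𝒟 1).support) : y₁ = y₂ := by
  obtain ⟨𝔔₁, χ₁, hχ₁, hloc₁, h𝔔₁, h𝔞₁⟩ := exists_chartOnePresentation_of_mem_support hτ 𝒟 y₁ h₁ c hc h𝒟 hy₁
  obtain ⟨𝔔₂, χ₂, hχ₂, hloc₂, h𝔔₂, h𝔞₂⟩ := exists_chartOnePresentation_of_mem_support hτ 𝒟 y₂ h₂ c hc h𝒟 hy₂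
  have h𝔔 : 𝔔₁ = 𝔔₂ :=
    PrimeSpectrum.ext (eq_of_directionCentre_le_of_comap_eq c 1 h𝔞₁ h𝔞₂ (by rw [h𝔔₁, h𝔔₂]))
  subst h𝔔
  exact eq_of_chartPresentation_of_prime_eq hτ h₁ h₂ c 1 𝔔₁ χ₁ χ₂ hχ₁ hχ₂ hloc₁ hloc₂

/-- **Existence: over each `x ∈ C` there is a point of `V(Γ̃)`** — the point of the blow-up with chart-`m` prime `𝔞 + 𝔪_x·B`
(`I_x` quasi-regular). [cite: StacksProject, Tag 0804] -/
theorem exists_mem_support_directionCentre (hτ : IsBlowup τ I) (𝒟 : X.IdealSheafData) (x : X) (hx : x ∈ I.support)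
    (c : Fin 2 → X.presheaf.stalk x) (hc : Ideal.span (Set.range c) = stalkIdeal I x) (hqr : IsQuasiRegular c)
    (h𝒟 : stalkIdeal 𝒟 x = Ideal.span {c 0} ⊔ Ideal.span {c 1 * c 1}) :
    ∃ y ∈ (controlledTransform τ I 𝒟 1).support, τ y = x := by
  have hI𝔪 : Ideal.span (Set.range c) ≤ maximalIdeal _ := hc ▸ (mem_support_iff_stalkIdeal_le I x).mp hx
  obtain ⟨hprime, hcomap⟩ := isPrime_directionCentre_sup_map c 1 hqr (maximalIdeal _) hI𝔪
  let 𝔔₀ : PrimeSpectrum (blowupAlgebra (Ideal.span (Set.range c)) (c 1)) := ⟨_, hprime⟩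
  obtain ⟨y, hy, χ, e, hχ, he⟩ := exists_point_presentation_of_blowupAlgebra_prime hτ x c hc 1 𝔔₀ hcomap
  have hloc := isLocalization_stalk_of_ringEquiv 𝔔₀ y χ e he
  have hχ' : ∀ a, χ (algebraMap _ _ a) = ((X.presheaf.stalkCongr (.of_eq hy)).inv ≫ τ.stalkMap y).hom a := fun a => by
    rw [stalkCongr_inv_comp_stalkMap_hom_apply τ y hy a]
    exact hχ a
  refine ⟨y, ?_, hy⟩
  rw [mem_support_iff_stalkIdeal_le, stalkIdeal_directionCentre_eq_map hτ 𝒟 y hy c hc h𝒟 χ hχ', Ideal.map_le_iff_le_comap]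
  intro b hb
  rw [Ideal.mem_comap, ← mem_chartPrime_iff_apply_mem_maximalIdeal 𝔔₀ χ hloc]
  exact Ideal.mem_sup_left hb

/-! ## 3. The stalk of `V(Γ̃)` is the stalk of `C` -/

/-- **`𝒪_{X,x} → 𝒪_{X₁,y} ⧸ Γ̃_y` is surjective** at a point `y ∈ V(Γ̃)` over `x`. [cite: StacksProject, Tag 0804] -/
theorem surjective_mk_comp_of_mem_support_directionCentre (hτ : IsBlowup τ I) (𝒟 : X.IdealSheafData) (y : X₁) {x : X}
    (hy : τ y = x) (c : Fin 2 → X.presheaf.stalk x) (hc : Ideal.span (Set.range c) = stalkIdeal I x)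
    (h𝒟 : stalkIdeal 𝒟 x = Ideal.span {c 0} ⊔ Ideal.span {c 1 * c 1})
    (hyΓ : y ∈ (controlledTransform τ I 𝒟 1).support) :
    Function.Surjective ((Ideal.Quotient.mk (stalkIdeal (controlledTransform τ I 𝒟 1) y)).comp
      ((X.presheaf.stalkCongr (.of_eq hy)).inv ≫ τ.stalkMap y).hom) := by
  obtain ⟨𝔔, χ, hχ, hloc, h𝔔, h𝔞𝔔⟩ := exists_chartOnePresentation_of_mem_support hτ 𝒟 y hy c hc h𝒟 hyΓ
  letI := χ.toAlgebra
  haveI : IsLocalization.AtPrime (X₁.presheaf.stalk y) 𝔔.asIdeal := hloc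
  have hT : (algebraMap _ (X₁.presheaf.stalk y)).comp (algebraMap _ (blowupAlgebra (Ideal.span (Set.range c)) (c 1))) =
      ((X.presheaf.stalkCongr (.of_eq hy)).inv ≫ τ.stalkMap y).hom := RingHom.ext fun a => hχ a
  rw [stalkIdeal_directionCentre_eq_map hτ 𝒟 y hy c hc h𝒟 χ hχ, ← hT]
  exact surjective_mk_map_directionCentre_comp c 1 𝔔.asIdeal h𝔞𝔔 h𝔔

/-- **The kernel of `𝒪_{X,x} → 𝒪_{X₁,y} ⧸ Γ̃_y` is `I_x`** at a point `y ∈ V(Γ̃)` over `x` (`I_x` quasi-regular). [cite: StacksProject, Tag 0804] -/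
theorem comap_stalkIdeal_directionCentre (hτ : IsBlowup τ I) (𝒟 : X.IdealSheafData) (y : X₁) {x : X}
    (hy : τ y = x) (c : Fin 2 → X.presheaf.stalk x) (hc : Ideal.span (Set.range c) = stalkIdeal I x) (hqr : IsQuasiRegular c)
    (h𝒟 : stalkIdeal 𝒟 x = Ideal.span {c 0} ⊔ Ideal.span {c 1 * c 1})
    (hyΓ : y ∈ (controlledTransform τ I 𝒟 1).support) :
    (stalkIdeal (controlledTransform τ I 𝒟 1) y).comap ((X.presheaf.stalkCongr (.of_eq hy)).inv ≫ τ.stalkMap y).hom =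
      stalkIdeal I x := by
  obtain ⟨𝔔, χ, hχ, hloc, h𝔔, h𝔞𝔔⟩ := exists_chartOnePresentation_of_mem_support hτ 𝒟 y hy c hc h𝒟 hyΓ
  letI := χ.toAlgebra
  haveI : IsLocalization.AtPrime (X₁.presheaf.stalk y) 𝔔.asIdeal := hloc
  have hT : (algebraMap _ (X₁.presheaf.stalk y)).comp (algebraMap _ (blowupAlgebra (Ideal.span (Set.range c)) (c 1))) =
      ((X.presheaf.stalkCongr (.of_eq hy)).inv ≫ τ.stalkMap y).hom := RingHom.ext fun a => hχ a
  have key := comap_map_directionCentre (S := X₁.presheaf.stalk y) c 1 hqr 𝔔.asIdeal h𝔞𝔔 h𝔔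
  rw [stalkIdeal_directionCentre_eq_map hτ 𝒟 y hy c hc h𝒟 χ hχ, ← hT, ← hc]
  exact key

/-! ## 4. `V(Γ̃) ≅ C` over `X` -/

/-- `τ^*I ≤ Γ̃` when `I·I ≤ 𝒟` (so `I ≤ τ_*Γ̃` and `τ` restricts to `V(Γ̃) → V(I)`). [cite: BierstoneGrigorievMilmanWlodarczyk2011, §3.2] -/
theorem comap_le_directionCentre (τ : X₁ ⟶ X) (I 𝒟 : X.IdealSheafData) (hI𝒟 : I * I ≤ 𝒟) :
    I.comap τ ≤ controlledTransform τ I 𝒟 1 := by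
  rw [controlledTransform, le_colon_iff, pow_one, ← comap_mul]
  exact Scheme.IdealSheafData.comap_mono τ hI𝒟

/-- **The direction centre is a section of `E_C → C`: `V(Γ̃) ≅ C` over `X`.** For a blowing up `τ : X₁ → X` along `I` with `τ`
universally closed and a direction `𝒟` along `C = V(I)` (`I·I ≤ 𝒟`; at each `x ∈ C` a quasi-regular frame `(ℓ, m)` of `I_x` with
`𝒟_x = (ℓ) + (m²)`), the restriction of `τ` is an isomorphism `V(Γ̃) ≅ V(I)`, `Γ̃ = controlledTransform τ I 𝒟 1`.
[cite: StacksProject, Tags 0804, 01J5] -/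
theorem exists_subschemeIso_directionCentre (hτ : IsBlowup τ I) [UniversallyClosed τ] (𝒟 : X.IdealSheafData)
    (hI𝒟 : I * I ≤ 𝒟)
    (hdir : ∀ x ∈ I.support, ∃ c : Fin 2 → X.presheaf.stalk x, Ideal.span (Set.range c) = stalkIdeal I x ∧
      IsQuasiRegular c ∧ stalkIdeal 𝒟 x = Ideal.span {c 0} ⊔ Ideal.span {c 1 * c 1}) :
    ∃ e : (controlledTransform τ I 𝒟 1).subscheme ≅ I.subscheme,
      e.hom ≫ I.subschemeι = (controlledTransform τ I 𝒟 1).subschemeι ≫ τ := by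
  have hH : I ≤ (controlledTransform τ I 𝒟 1).map τ :=
    le_trans (Scheme.IdealSheafData.le_map_comap I τ) (Scheme.IdealSheafData.map_mono τ (comap_le_directionCentre τ I 𝒟 hI𝒟))
  let φ := Scheme.IdealSheafData.subschemeMap (controlledTransform τ I 𝒟 1) I τ hH
  have hfac : φ ≫ I.subschemeι = (controlledTransform τ I 𝒟 1).subschemeι ≫ τ :=
    Scheme.IdealSheafData.subschemeMap_subschemeι _ _ _ _
  have hpt : ∀ z, I.subschemeι (φ z) = τ ((controlledTransform τ I 𝒟 1).subschemeι z) := fun z => by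
    rw [← Scheme.Hom.comp_apply, hfac, Scheme.Hom.comp_apply]
  have hmemΓ : ∀ z : (controlledTransform τ I 𝒟 1).subscheme,
      (controlledTransform τ I 𝒟 1).subschemeι z ∈ (controlledTransform τ I 𝒟 1).support := fun z => by
    have h : (controlledTransform τ I 𝒟 1).subschemeι z ∈ ((controlledTransform τ I 𝒟 1).support : Set X₁) := by
      rw [← Scheme.IdealSheafData.range_subschemeι]
      exact ⟨z, rfl⟩
    exact h
  have hmemI : ∀ w : I.subscheme, I.subschemeι w ∈ I.support := fun w => by
    have h : I.subschemeι w ∈ (I.support : Set X) := by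
      rw [← Scheme.IdealSheafData.range_subschemeι]
      exact ⟨w, rfl⟩
    exact h
  -- bijective on points
  have hinj : Function.Injective φ := fun z₁ z₂ h => by
    apply (controlledTransform τ I 𝒟 1).subschemeι.isClosedEmbedding.injective
    obtain ⟨c, hc, -, h𝒟⟩ := hdir _ (hmemI (φ z₁))
    refine eq_of_mem_support_directionCentre hτ 𝒟 c hc h𝒟 (hpt z₁).symm ?_ (hmemΓ z₁) (hmemΓ z₂)
    rw [h]
    exact (hpt z₂).symm
  have hsurj : Function.Surjective φ := fun w => by
    obtain ⟨c, hc, hqr, h𝒟⟩ := hdir _ (hmemI w)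
    obtain ⟨y, hyΓ, hyx⟩ := exists_mem_support_directionCentre hτ 𝒟 (I.subschemeι w) (hmemI w) c hc hqr h𝒟
    obtain ⟨z, rfl⟩ : y ∈ Set.range (controlledTransform τ I 𝒟 1).subschemeι := by
      rw [Scheme.IdealSheafData.range_subschemeι]; exact hyΓ
    refine ⟨z, I.subschemeι.isClosedEmbedding.injective ?_⟩
    rw [hpt, hyx]
  -- closed, hence a homeomorphism
  have hclosed : IsClosedMap φ := fun F hF => by
    have h1 : IsClosed (τ '' ((controlledTransform τ I 𝒟 1).subschemeι '' F)) :=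
      τ.isClosedMap _ ((controlledTransform τ I 𝒟 1).subschemeι.isClosedEmbedding.isClosedMap _ hF)
    have h2 : I.subschemeι '' (φ '' F) = τ '' ((controlledTransform τ I 𝒟 1).subschemeι '' F) := by
      rw [Set.image_image, Set.image_image]
      exact Set.image_congr fun z _ => hpt z
    rw [I.subschemeι.isClosedEmbedding.isClosed_iff_image_isClosed, h2]
    exact h1
  haveI hbase : IsIso φ.base := TopCat.isIso_of_bijective_of_isClosedMap _ ⟨hinj, hsurj⟩ hclosed
  -- stalks
  have hstalk : ∀ z, Function.Bijective (φ.stalkMap z).hom := by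
    intro z
    obtain ⟨c, hc, hqr, h𝒟⟩ := hdir _ (hmemI (φ z))
    have hy : τ ((controlledTransform τ I 𝒟 1).subschemeι z) = I.subschemeι (φ z) := (hpt z).symm
    have hsurjT := surjective_mk_comp_of_mem_support_directionCentre hτ 𝒟 _ hy c hc h𝒟 (hmemΓ z)
    have hcomapT := comap_stalkIdeal_directionCentre hτ 𝒟 _ hy c hc hqr h𝒟 (hmemΓ z)
    have hq₁ := (controlledTransform τ I 𝒟 1).subschemeι.stalkMap_surjective z
    have hqI := I.subschemeι.stalkMap_surjective (φ z)
    have hker₁ : RingHom.ker ((controlledTransform τ I 𝒟 1).subschemeι.stalkMap z).hom =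
        stalkIdeal (controlledTransform τ I 𝒟 1) ((controlledTransform τ I 𝒟 1).subschemeι z) := by
      rw [← stalkIdeal_ker_eq_ker_stalkMap, Scheme.IdealSheafData.ker_subschemeι]
    have hkerI : RingHom.ker (I.subschemeι.stalkMap (φ z)).hom = stalkIdeal I (I.subschemeι (φ z)) := by
      rw [← stalkIdeal_ker_eq_ker_stalkMap, Scheme.IdealSheafData.ker_subschemeι]
    -- the stalk maps commute with `τ♯`
    have hrel : ∀ a, (φ.stalkMap z).hom ((I.subschemeι.stalkMap (φ z)).hom a) =
        ((controlledTransform τ I 𝒟 1).subschemeι.stalkMap z).hom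
          (((X.presheaf.stalkCongr (.of_eq hy)).inv ≫ τ.stalkMap ((controlledTransform τ I 𝒟 1).subschemeι z)).hom a) := by
      intro a
      have h := Scheme.Hom.stalkMap_congr_hom _ _ hfac z
      rw [Scheme.Hom.stalkMap_comp, Scheme.Hom.stalkMap_comp] at h
      have h' := DFunLike.congr_fun (congrArg CommRingCat.Hom.hom h) a
      simp only [CommRingCat.hom_comp, RingHom.comp_apply] at h'
      rw [h', CommRingCat.hom_comp, RingHom.comp_apply]
      rfl
    constructor
    · rw [injective_iff_map_eq_zero]
      intro v hv
      obtain ⟨a, rfl⟩ := hqI v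
      rw [hrel, ← RingHom.mem_ker, hker₁, ← Ideal.mem_comap, hcomapT, ← hkerI] at hv
      exact hv
    · intro t
      obtain ⟨b, rfl⟩ := hq₁ t
      obtain ⟨a, ha⟩ := hsurjT (Ideal.Quotient.mk _ b)
      refine ⟨(I.subschemeι.stalkMap (φ z)).hom a, ?_⟩
      rw [hrel]
      rw [RingHom.comp_apply, Ideal.Quotient.mk_eq_mk_iff_sub_mem, ← hker₁, RingHom.mem_ker, map_sub, sub_eq_zero] at ha
      exact ha
  haveI : IsIso φ := by
    have h : MorphismProperty.isomorphisms Scheme φ := by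
      rw [isomorphisms_eq_stalkwise]
      exact ⟨hbase, hstalk⟩
    exact h
  exact ⟨asIso φ, by rw [asIso_hom]; exact hfac⟩

/-- **`V(Γ̃) ≅ C` over `X`, locally Noetherian base** — the same with `τ` proper because `X` is locally Noetherian (tree
`IsBlowup.isProper`). [cite: StacksProject, Tags 0804, 01J5] -/
theorem exists_subschemeIso_directionCentre_of_isLocallyNoetherian [IsLocallyNoetherian X] (hτ : IsBlowup τ I)
    (𝒟 : X.IdealSheafData) (hI𝒟 : I * I ≤ 𝒟)
    (hdir : ∀ x ∈ I.support, ∃ c : Fin 2 → X.presheaf.stalk x, Ideal.span (Set.range c) = stalkIdeal I x ∧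
      IsQuasiRegular c ∧ stalkIdeal 𝒟 x = Ideal.span {c 0} ⊔ Ideal.span {c 1 * c 1}) :
    ∃ e : (controlledTransform τ I 𝒟 1).subscheme ≅ I.subscheme,
      e.hom ≫ I.subschemeι = (controlledTransform τ I 𝒟 1).subschemeι ≫ τ := by
  haveI : IsProper τ := hτ.isProper
  exact exists_subschemeIso_directionCentre hτ 𝒟 hI𝒟 hdir

end Summit.ResolutionOfSingularities.ResolutionOfSingularities.Cruxes.EquisingularLiftNat.Sections

end
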